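import Mathlib
import Summits.QuantumFields.BalabanUV.Beta.UnitLatticeTubeCount
import Summits.QuantumFields.BalabanUV.Beta.UnitLatticeOmegaTerms

/-!
# `Summit.QuantumFields.BalabanUV.Beta.UnitLatticeOmegaTube` — A3-loc-ω (II): THE TUBE COUNT FOR THE FULL DECORATION
# (cells met by the cube neighbourhoods `□̃_{b_t}` AND by the domains `D_{ω_t}` of the kernel pieces used): for every
# admissible chain `y`, `#decΩ ≤ P·(1 + (pathLen(y) + Σ_t cr(ω_t))/r)` with the step credit `cr(ω) ≥ 3·len(ω) + 2·D_f`
# (`len(ω)` = length of a THREAD through `D_ω`, `D_f` = its covering radius) — composable point-anchors along the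
# concatenated chain `y_{t−1} → thread(ω_t) → y_t`

HONEST FRAMING (page 1 of everything in this cell).  Discharging `FlowStep.BetaPertH` would make Bałaban's ultraviolet
stability UNCONDITIONAL — a constructive-QFT result; NOT the continuum limit, NOT the Clay problem.  This module
discharges nothing of `BetaPertH`; [folklore] metric combinatorics, kernel-checked (unit `b2b-balaban-beta-d4-p3`, road P3,
gen 4; skeleton v1.9 §7.6 «A3-loc-ω»).  HONEST COST, displayed: each step pays the additive `2·D_f` (the side trip from the
chain into the thread of `ω_t` and back), i.e. a per-step factor `e^{δ·2D_f}` downstream (`δ = κ₁P/r`, so `→ 1` as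
`M_d/M_w → ∞`); Bałaban's single-level expansion ([II] (1.11)) has no such term.  Symmetry of `d` is assumed here (true
for the sup-distance instances); the rest of the lineage's modules do not use it.
HONEST DEPENDENCY: continuum YM on T⁴ ⇐ BetaPertH ∧ nine spine estimates (0/9 proved); BetaPertH ⇐
(D1) ∧ (D4) ∧ CAP+tail; G-an2-4 gates asym, D1 and NE2/3/4.

CONTENTS (0 sorry).  §1 `listLen`, `lastOf`, length∕distance lemmas along a list (`dist_head_le_listLen`,
`dist_last_le_listLen`, `listLen_append_singleton`, `listLen_step_le`: `listLen(u :: θ ++ [v]) ≤ d(u,v) + 3·listLen θ + 2·D_f`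
when `θ` passes within `D_f` of `u`).  §2 **`anchors_extend`** — the COMPOSABLE anchor lemma (anchors are POINTS; attaching a
list after the current end point keeps «every point within `r` of an anchor» and «(#A − 1)·r + d(last anchor, end) ≤ Λ +
attached length»).  §3 `decΩ` (recursive, as `AdmΩ`), `crSum`, **`exists_anchorsΩ`** (coverage of every decoration cell
within `R` of an anchor, `R ≥ r + D`, `R ≥ r + D_f`) and **`card_decΩ_le`**.
NOT HERE: majorants∕credits (`UnitLatticeOmegaPaths`), the `RowData` hand-off, any instance.  NOT summit progress.
-/

open scoped BigOperators
open Finset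

namespace Summit.QuantumFields.BalabanUV.Beta.UnitLatticeOmegaTube

open Summit.QuantumFields.BalabanUV.Beta.UnitLatticeTubeCount (pathLen pathLen_succ pathLen_nonneg)
open Summit.QuantumFields.BalabanUV.Beta.UnitLatticeOmegaTerms (AdmΩ)

noncomputable section

variable {Y : Type*} {B Ω : Type*}

/-! ## §1 Lengths along lists -/

/-- The LENGTH of a list read as a point chain: `Σ d(consecutive)`. [folklore] -/
def listLen (d : Y → Y → ℝ) : List Y → ℝ
  | [] => 0
  | [_] => 0
  | a :: b :: t => d a b + listLen d (b :: t)

/-- The LAST point of the chain `p :: l`. [folklore] -/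
def lastOf : Y → List Y → Y
  | p, [] => p
  | _, q :: t => lastOf q t

/-- Unfolding `listLen` at two leading points. [folklore] -/
theorem listLen_cons_cons (d : Y → Y → ℝ) (a b : Y) (t : List Y) :
    listLen d (a :: b :: t) = d a b + listLen d (b :: t) := rfl

/-- `listLen ≥ 0` for nonnegative `d`. [folklore] -/
theorem listLen_nonneg (d : Y → Y → ℝ) (hnn : ∀ a b, 0 ≤ d a b) : ∀ l : List Y, 0 ≤ listLen d l
  | [] => le_rfl
  | [_] => le_rfl
  | a :: b :: t => add_nonneg (hnn a b) (listLen_nonneg d hnn (b :: t))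

/-- The head is within `listLen` of every point of the chain. [folklore] -/
theorem dist_head_le_listLen (d : Y → Y → ℝ) (htri : ∀ a b c, d a c ≤ d a b + d b c) (hzero : ∀ a, d a a = 0)
    (hnn : ∀ a b, 0 ≤ d a b) : ∀ (p : Y) (l : List Y) (x : Y), x ∈ p :: l → d p x ≤ listLen d (p :: l)
  | p, [], x, hx => by
      rw [List.mem_singleton.1 hx, hzero]
      exact le_rfl
  | p, q :: t, x, hx => by
      rw [listLen_cons_cons]
      rcases List.mem_cons.1 hx with rfl | hx
      · rw [hzero]
        exact add_nonneg (hnn _ _) (listLen_nonneg d hnn _)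
      · exact (htri p q x).trans (add_le_add le_rfl (dist_head_le_listLen d htri hzero hnn q t x hx))

/-- Every point of the chain is within `listLen` of the last point. [folklore] -/
theorem dist_last_le_listLen (d : Y → Y → ℝ) (htri : ∀ a b c, d a c ≤ d a b + d b c) (hzero : ∀ a, d a a = 0)
    (hnn : ∀ a b, 0 ≤ d a b) : ∀ (p : Y) (l : List Y) (x : Y), x ∈ p :: l → d x (lastOf p l) ≤ listLen d (p :: l)
  | p, [], x, hx => by
      rw [List.mem_singleton.1 hx, lastOf, hzero]
      exact le_rfl
  | p, q :: t, x, hx => by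
      rw [listLen_cons_cons, lastOf]
      have ih := dist_last_le_listLen d htri hzero hnn q t
      rcases List.mem_cons.1 hx with rfl | hx
      · exact (htri x q _).trans (add_le_add le_rfl (ih q (List.mem_cons_self)))
      · exact (ih x hx).trans (le_add_of_nonneg_left (hnn _ _))

/-- `lastOf p (l ++ [v]) = v`. [folklore] -/
theorem lastOf_append_singleton : ∀ (p : Y) (l : List Y) (v : Y), lastOf p (l ++ [v]) = v
  | _, [], _ => rfl
  | _, q :: t, v => lastOf_append_singleton q t v

/-- `listLen ((p :: l) ++ [v]) = listLen (p :: l) + d (last) v`. [folklore] -/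
theorem listLen_append_singleton (d : Y → Y → ℝ) :
    ∀ (p : Y) (l : List Y) (v : Y), listLen d ((p :: l) ++ [v]) = listLen d (p :: l) + d (lastOf p l) v
  | p, [], v => by simp [listLen, lastOf]
  | p, q :: t, v => by
      rw [List.cons_append, List.cons_append, listLen_cons_cons, ← List.cons_append,
        listLen_append_singleton d q t v, listLen_cons_cons, lastOf]
      ring

/-- **THE STEP LENGTH.**  If the thread `θ` passes within `D_f` of `u` (some `p ∈ θ` with `d(u,p) ≤ D_f`) and `d` is
symmetric, then `listLen (u :: θ ++ [v]) ≤ d(u,v) + 3·listLen θ + 2·D_f` (enter at cost `≤ D_f + len`, traverse `len`,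
exit at cost `≤ len + D_f + d(u,v)`). [folklore] -/
theorem listLen_step_le (d : Y → Y → ℝ) (htri : ∀ a b c, d a c ≤ d a b + d b c) (hzero : ∀ a, d a a = 0)
    (hnn : ∀ a b, 0 ≤ d a b) (hsymm : ∀ a b, d a b = d b a) {Df : ℝ} (u v : Y) (θ : List Y) {p : Y} (hp : p ∈ θ)
    (hup : d u p ≤ Df) : listLen d (u :: (θ ++ [v])) ≤ d u v + 3 * listLen d θ + 2 * Df := by
  obtain ⟨q, t, rfl⟩ : ∃ q t, θ = q :: t := by
    cases θ with
    | nil => exact absurd hp List.not_mem_nil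
    | cons q t => exact ⟨q, t, rfl⟩
  rw [List.cons_append, listLen_cons_cons, ← List.cons_append, listLen_append_singleton]
  have h1 : d u q ≤ Df + listLen d (q :: t) := by
    have := dist_head_le_listLen d htri hzero hnn q t p hp
    rw [hsymm] at this
    linarith [htri u p q]
  have h2 : d (lastOf q t) v ≤ listLen d (q :: t) + Df + d u v := by
    have hl := dist_last_le_listLen d htri hzero hnn q t p hp
    rw [hsymm] at hl
    rw [hsymm u p] at hup
    linarith [htri (lastOf q t) p v, htri p u v]
  linarith

/-! ## §2 Composable anchors -/

/-- **COMPOSABLE ANCHORS.**  Anchors are POINTS `A ⊆ Y` with a distinguished last anchor `a`; the invariant is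
`(#A − 1)·r + d(a, current end) ≤ Λ`.  Attaching a list `l` after the current end `p`: there are anchors `A′ ⊇ A`, last
anchor `a′`, every point of `l` within `r` of an anchor, and `(#A′ − 1)·r + d(a′, new end) ≤ Λ + listLen (p :: l)`
(a new anchor is opened exactly when the chain leaves the `r`-ball of the last one). [folklore] -/
theorem anchors_extend [DecidableEq Y] (d : Y → Y → ℝ) (htri : ∀ a b c, d a c ≤ d a b + d b c)
    (hzero : ∀ a, d a a = 0) {r : ℝ} (hr : 0 ≤ r) :
    ∀ (l : List Y) (p : Y) (A : Finset Y) (a : Y) (Λ : ℝ), a ∈ A → ((A.card : ℝ) - 1) * r + d a p ≤ Λ →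
      ∃ (A' : Finset Y) (a' : Y), A ⊆ A' ∧ a' ∈ A' ∧ (∀ z ∈ l, ∃ s ∈ A', d s z ≤ r) ∧
        ((A'.card : ℝ) - 1) * r + d a' (lastOf p l) ≤ Λ + listLen d (p :: l)
  | [], p, A, a, Λ, ha, hinv =>
      ⟨A, a, subset_rfl, ha, fun z hz => absurd hz List.not_mem_nil, by simpa [lastOf, listLen] using hinv⟩
  | q :: t, p, A, a, Λ, ha, hinv => by
      have hq : ((A.card : ℝ) - 1) * r + d a q ≤ Λ + d p q := by linarith [htri a p q]
      by_cases hnear : d a q ≤ r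
      · obtain ⟨A', a', hsub, ha', hcov, hinv'⟩ := anchors_extend d htri hzero hr t q A a (Λ + d p q) ha hq
        refine ⟨A', a', hsub, ha', fun z hz => ?_, ?_⟩
        · rcases List.mem_cons.1 hz with rfl | hz
          · exact ⟨a, hsub ha, hnear⟩
          · exact hcov z hz
        · rw [lastOf, listLen_cons_cons]
          linarith
      · have hcard : (((insert q A).card : ℕ) : ℝ) ≤ A.card + 1 := by exact_mod_cast Finset.card_insert_le q A
        have hq' : (((insert q A).card : ℝ) - 1) * r + d q q ≤ Λ + d p q := by
          rw [hzero]
          have h1 : (((insert q A).card : ℝ) - 1) * r ≤ ((A.card : ℝ) - 1) * r + r := by nlinarith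
          linarith [not_le.1 hnear]
        obtain ⟨A', a', hsub, ha', hcov, hinv'⟩ :=
          anchors_extend d htri hzero hr t q (insert q A) q (Λ + d p q) (Finset.mem_insert_self q A) hq'
        refine ⟨A', a', (Finset.subset_insert q A).trans hsub, ha', fun z hz => ?_, ?_⟩
        · rcases List.mem_cons.1 hz with rfl | hz
          · exact ⟨z, hsub (Finset.mem_insert_self _ _), by rw [hzero]; exact hr⟩
          · exact hcov z hz
        · rw [lastOf, listLen_cons_cons]
          linarith

/-! ## §3 The full decoration and its count -/

section Count

variable {Δ : Type*} [DecidableEq Δ]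

/-- THE FULL DECORATION of a term `(b₀; (b_t, ω_t)_t)`: the cells met by the cube neighbourhoods `□̃_{b_t}` and by the
domains `D_{ω_t}` of the kernel pieces (recursion as `AdmΩ`). [folklore] -/
def decΩ (cellOf : Y → Δ) (E : B → Finset Y) (Dω : Ω → Finset Y) : (n : ℕ) → B → (Fin n → B × Ω) → Finset Δ
  | 0, b₀, _ => (E b₀).image cellOf
  | n + 1, b₀, c => decΩ cellOf E Dω n b₀ (Fin.init c) ∪ (Dω (c (Fin.last n)).2).image cellOf ∪
      (E (c (Fin.last n)).1).image cellOf

/-- The accumulated STEP CREDITS `Σ_t cr(ω_t)` (recursion as `AdmΩ`). [folklore] -/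
def crSum (cr : Ω → ℝ) : (n : ℕ) → (Fin n → B × Ω) → ℝ
  | 0, _ => 0
  | n + 1, c => crSum cr n (Fin.init c) + cr (c (Fin.last n)).2

/-- `crSum ≥ 0` for nonnegative credits. [folklore] -/
theorem crSum_nonneg (cr : Ω → ℝ) (hcr : ∀ ω, 0 ≤ cr ω) : ∀ (n : ℕ) (c : Fin n → B × Ω), 0 ≤ crSum cr n c
  | 0, _ => le_rfl
  | n + 1, c => add_nonneg (crSum_nonneg cr hcr n (Fin.init c)) (hcr (c (Fin.last n)).2)

/-- **ANCHORS FOR THE FULL DECORATION.**  Symmetric pseudo-metric; cube neighbourhoods of diameter `≤ D`; every domain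
`D_ω` covered within `D_f` by the points of a thread `thr ω`; step credits `cr ω ≥ 3·listLen(thr ω) + 2·D_f`; `0 ≤ r`,
`r + D ≤ R`, `r + D_f ≤ R`.  For every ADMISSIBLE chain `y` of a term there are anchor points `A` with last anchor `a` such
that every decoration cell has a point within `R` of an anchor and `(#A − 1)·r + d(a, y_n) ≤ pathLen(y) + crSum`. [folklore] -/
theorem exists_anchorsΩ [DecidableEq Y] (d : Y → Y → ℝ) (htri : ∀ a b c, d a c ≤ d a b + d b c)
    (hzero : ∀ a, d a a = 0) (hnn : ∀ a b, 0 ≤ d a b) (hsymm : ∀ a b, d a b = d b a) {r D Df R : ℝ} (hr : 0 ≤ r)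
    (hRD : r + D ≤ R) (hRf : r + Df ≤ R) (cellOf : Y → Δ) (E : B → Finset Y)
    (hdiam : ∀ b, ∀ z ∈ E b, ∀ z' ∈ E b, d z z' ≤ D) (Dω : Ω → Finset Y) (thr : Ω → List Y)
    (hthr : ∀ ω, ∀ z ∈ Dω ω, ∃ p ∈ thr ω, d z p ≤ Df) (cr : Ω → ℝ) (hcr : ∀ ω, 3 * listLen d (thr ω) + 2 * Df ≤ cr ω) :
    ∀ (n : ℕ) (b₀ : B) (c : Fin n → B × Ω) (y : Fin (n + 1) → Y), AdmΩ E Dω n b₀ c y →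
      ∃ (A : Finset Y) (a : Y), a ∈ A ∧
        (∀ δ ∈ decΩ cellOf E Dω n b₀ c, ∃ s ∈ A, ∃ z, cellOf z = δ ∧ d s z ≤ R) ∧
        ((A.card : ℝ) - 1) * r + d a (y (Fin.last n)) ≤ pathLen d n y + crSum cr n c
  | 0, b₀, c, y, hy => by
      refine ⟨{y 0}, y 0, Finset.mem_singleton_self _, fun δ hδ => ?_, ?_⟩
      · obtain ⟨z, hz, rfl⟩ := Finset.mem_image.1 hδ
        exact ⟨y 0, Finset.mem_singleton_self _, z, rfl, (hdiam b₀ (y 0) hy z hz).trans (by linarith)⟩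
      · have h0 : Fin.last 0 = 0 := rfl
        rw [Finset.card_singleton, h0, hzero]
        simp [pathLen, crSum]
  | n + 1, b₀, c, y, hy => by
      obtain ⟨hy0, hyD, hyE⟩ := hy
      obtain ⟨A₀, a₀, ha₀, hcov₀, hinv₀⟩ :=
        exists_anchorsΩ d htri hzero hnn hsymm hr hRD hRf cellOf E hdiam Dω thr hthr cr hcr n b₀ (Fin.init c) (Fin.init y) hy0
      -- abbreviations for the new step
      set ω := (c (Fin.last n)).2 with hω
      set b' := (c (Fin.last n)).1 with hb'
      set u := y (Fin.last n).castSucc with hu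
      set v := y (Fin.last (n + 1)) with hv
      have hinit : (Fin.init y) (Fin.last n) = u := rfl
      rw [hinit] at hinv₀
      -- attach the thread of ω and the new point
      obtain ⟨A', a', hsub, ha', hcov, hinv'⟩ := anchors_extend d htri hzero hr (thr ω ++ [v]) u A₀ a₀
        (pathLen d n (Fin.init y) + crSum cr n (Fin.init c)) ha₀ hinv₀
      obtain ⟨p, hp, hup⟩ := hthr ω u hyD
      have hlen := listLen_step_le d htri hzero hnn hsymm u v (thr ω) hp hup (Df := Df)
      refine ⟨A', a', ha', fun δ hδ => ?_, ?_⟩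
      · rcases Finset.mem_union.1 hδ with hδ | hδ
        · rcases Finset.mem_union.1 hδ with hδ | hδ
          · obtain ⟨s, hs, z, hz, hsz⟩ := hcov₀ δ hδ
            exact ⟨s, hsub hs, z, hz, hsz⟩
          · obtain ⟨z, hz, rfl⟩ := Finset.mem_image.1 hδ
            obtain ⟨q, hq, hzq⟩ := hthr ω z hz
            obtain ⟨s, hs, hsq⟩ := hcov q (List.mem_append_left _ hq)
            refine ⟨s, hs, z, rfl, ?_⟩
            rw [hsymm] at hzq
            linarith [htri s q z]
        · obtain ⟨z, hz, rfl⟩ := Finset.mem_image.1 hδ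
          obtain ⟨s, hs, hsv⟩ := hcov v (List.mem_append_right _ (List.mem_singleton_self v))
          exact ⟨s, hs, z, rfl, by linarith [htri s v z, hdiam b' v hyE z hz]⟩
      · rw [lastOf_append_singleton] at hinv'
        rw [pathLen_succ, crSum]
        linarith [hcr ω]

/-- **THE TUBE COUNT FOR THE FULL DECORATION**: with PACKING (`≤ P` cells per `R`-ball) and `0 < r`, for every admissible
chain `y`, `#decΩ ≤ P·(1 + (pathLen(y) + crSum)/r)` — per-term constant `P`, slope `P/r` on the chain length AND on the
step credits. [folklore] -/
theorem card_decΩ_le [DecidableEq Y] (d : Y → Y → ℝ) (htri : ∀ a b c, d a c ≤ d a b + d b c) (hzero : ∀ a, d a a = 0)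
    (hnn : ∀ a b, 0 ≤ d a b) (hsymm : ∀ a b, d a b = d b a) {r D Df R : ℝ} (hr : 0 < r) (hRD : r + D ≤ R)
    (hRf : r + Df ≤ R) (cellOf : Y → Δ) {P : ℕ}
    (hpack : ∀ a : Y, ∃ S : Finset Δ, S.card ≤ P ∧ ∀ z, d a z ≤ R → cellOf z ∈ S) (E : B → Finset Y)
    (hdiam : ∀ b, ∀ z ∈ E b, ∀ z' ∈ E b, d z z' ≤ D) (Dω : Ω → Finset Y) (thr : Ω → List Y)
    (hthr : ∀ ω, ∀ z ∈ Dω ω, ∃ p ∈ thr ω, d z p ≤ Df) (cr : Ω → ℝ) (hcr : ∀ ω, 3 * listLen d (thr ω) + 2 * Df ≤ cr ω)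
    {n : ℕ} (b₀ : B) (c : Fin n → B × Ω) (y : Fin (n + 1) → Y) (hy : AdmΩ E Dω n b₀ c y) :
    ((decΩ cellOf E Dω n b₀ c).card : ℝ) ≤ P * (1 + (pathLen d n y + crSum cr n c) / r) := by
  obtain ⟨A, a, _, hcov, hinv⟩ :=
    exists_anchorsΩ d htri hzero hnn hsymm hr.le hRD hRf cellOf E hdiam Dω thr hthr cr hcr n b₀ c y hy
  choose S hS using hpack
  have hsub : decΩ cellOf E Dω n b₀ c ⊆ A.biUnion fun s => S s := by
    intro δ hδ
    obtain ⟨s, hs, z, hz, hsz⟩ := hcov δ hδ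
    exact Finset.mem_biUnion.2 ⟨s, hs, hz ▸ (hS s).2 z hsz⟩
  have hcardA : (A.card : ℝ) ≤ 1 + (pathLen d n y + crSum cr n c) / r := by
    have h1 : ((A.card : ℝ) - 1) * r ≤ pathLen d n y + crSum cr n c := by linarith [hnn a (y (Fin.last n))]
    have h2 : (A.card : ℝ) - 1 ≤ (pathLen d n y + crSum cr n c) / r := by rwa [le_div_iff₀ hr]
    linarith
  calc ((decΩ cellOf E Dω n b₀ c).card : ℝ) ≤ ((A.biUnion fun s => S s).card : ℝ) := by
        exact_mod_cast Finset.card_le_card hsub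
    _ ≤ ((∑ s ∈ A, (S s).card : ℕ) : ℝ) := by exact_mod_cast Finset.card_biUnion_le
    _ = ∑ s ∈ A, ((S s).card : ℝ) := by push_cast; rfl
    _ ≤ ∑ _s ∈ A, (P : ℝ) := Finset.sum_le_sum fun s _ => by exact_mod_cast (hS s).1
    _ = A.card * P := by rw [Finset.sum_const, nsmul_eq_mul]
    _ ≤ (1 + (pathLen d n y + crSum cr n c) / r) * P := mul_le_mul_of_nonneg_right hcardA (Nat.cast_nonneg P)
    _ = P * (1 + (pathLen d n y + crSum cr n c) / r) := mul_comm _ _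

end Count

end

end Summit.QuantumFields.BalabanUV.Beta.UnitLatticeOmegaTube
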